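import Summits.ResolutionOfSingularities.ResolutionOfSingularities.Theorems.EquisingularLiftEquisingularLiftNatCarrierDeltaFlat
import Summits.ResolutionOfSingularities.ResolutionOfSingularities.Theorems.EquisingularLiftEquisingularLiftNatCompleteIntersectionLiftAlgebra
import Summits.ResolutionOfSingularities.ResolutionOfSingularities.Theorems.EquisingularLiftEquisingularLiftNatRegularOfSpecialFibre
import Literature.AlgebraicGeometry.Resolution.SubschemeRegularStalks
import Summits.ResolutionOfSingularities.ResolutionOfSingularities.Theorems.EquisingularLiftEquisingularLiftSmoothNhdOfGoodAt
import HarnessLib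

/-!
# [OURS · L1 W4.5(b) · EL♮(3)] T-LIFT-CI, part 2 (CENTRE CRITERION): a closed subscheme `V(C)` of an `O`-scheme with good reduction
# whose stalk ideals over the closed point are cut out by «cotangent-lift» families is REGULAR and `O`-FLAT — the two centre
# clauses of a HorizChainE1 step, for complete-intersection noses

Cell `res-hironaka`, rung L, slot W4.5(b); crux **EL♮(3)** (stmt-ResolutionOfSingularities-20148), registered stub
`stub_elnat_three_nonisolated`; CUT (L1) T-LIFT-CI of res-D-pv-027 AS res-L1-s36-pv-4 (ENDORSED by res-L1-w45b-lead-2 2026-08-27T08:48:39Z,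
TARGET-CINOSE). OURS; NOT a statement of any manuscript; AI-written, weaker than expert review. No definition, no `sorry`, standard
axioms. `--supports stmt-ResolutionOfSingularities-20148 --as helper`. Part 1 = `…NatCompleteIntersectionLiftAlgebra` (ring core).

SETTING. `O` a discrete valuation ring with uniformiser `ϖ`, `q : X ⟶ Spec O`, `C` an ideal sheaf on `X`; `ϖ_x ∈ 𝒪_{X,x}` the germ
of `q^*ϖ` (spelled `Γgerm ∘ appTop ∘ ΓSpecIso⁻¹` as in the route's `GoodAt`).

* `flat_subschemeι_comp_of_forall_stalk` — **flatness criterion** (Hartshorne III 9.7: over a principal base flat = torsion-free;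
  pattern of `flat_carrierDelta_subschemeι_comp`, p-tree, made generic): if at every point `x ∈ V(C)` over the CLOSED point `ϖ_x` is
  regular modulo `C_x` (`ϖ_x·a ∈ C_x ⇒ a ∈ C_x`), then `V(C) → X → Spec O` is FLAT (over the generic point `ϖ` is a unit).
* `germ_varpi_mem_maximalIdeal` — over the closed point the germ `ϖ_x` lies in `𝔪_x` (via `stalkMap_Γgerm_apply'`, p-tree).
* `isRegular_and_flat_of_cotangentLift` — **the centre criterion**: `X` locally Noetherian, `V(C) → Spec O` universally closed,
  and at every `x ∈ V(C)` over the closed point: `𝒪_{X,x}` regular with `ϖ_x ∉ 𝔪_x²` (good reduction, the route's `GoodAt`) and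
  `C_x = (F₁,…,F_c)` for germs `Fᵢ ∈ 𝔪_x` satisfying part 1's DOWNSTAIRS hypothesis «`Σ aᵢFᵢ ∈ 𝔪_x² + (ϖ_x) ⇒ aᵢ ∈ 𝔪_x`»
  (independent differentials in the special fibre — supplied from a Jacobian minor by part 1 §3). THEN `V(C)` is a REGULAR scheme
  (part 1 `isRegularLocalRing_quotient_span_range_tail` at the special points, spread by `Scheme.isRegular_subscheme_of_forall_over_closedPoint`)
  and `V(C) → Spec O` is FLAT (part 1 `mem_span_range_of_mul_mem` + the criterion above).

References: R. Hartshorne, *Algebraic Geometry* (1977), III Prop. 9.7 [Hartshorne1977]; H. Matsumura, *Commutative Ring Theory* (1986),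
Thms. 14.2, 14.3 [Matsumura1987]; cell: CHAIN w45b v7.4.1, TARGET-CINOSE (lead-2).
-/

set_option linter.dupNamespace false -- mandated namespace `Summit.<Summit>.<Problem>` of this single-conjunct summit
set_option linter.overlappingInstances false -- signatures carry `[IsDomain O] [IsDiscreteValuationRing O]`

noncomputable section

open CategoryTheory AlgebraicGeometry TopologicalSpace IsLocalRing Opposite
open Literature.AlgebraicGeometry.Resolution

namespace Summit.ResolutionOfSingularities.ResolutionOfSingularities.Cruxes.EquisingularLiftNat.Sections

namespace CILift

variable (O : Type) [CommRing O] [IsDomain O] [IsDiscreteValuationRing O]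

/-- **Flatness over a DVR from `ϖ`-regularity on the special stalks** (Hartshorne III 9.7: over a principal ideal domain flat =
torsion-free; torsion-freeness of the sections of `V(C)` over an affine open is detected on the stalks, where `ϖ` is a unit over the
generic point and regular modulo `C_x` over the closed point by hypothesis). Generic form of `flat_carrierDelta_subschemeι_comp`.
[cite: Hartshorne1977, III Prop. 9.7 p. 257] -/
theorem flat_subschemeι_comp_of_forall_stalk {X : Scheme.{0}} (q : X ⟶ Spec (.of O)) (C : X.IdealSheafData)
    (ϖ : O) (hϖ : Irreducible ϖ)
    (h : ∀ x ∈ C.support, q x = IsLocalRing.closedPoint O →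
      ∀ a : X.presheaf.stalk x,
        (X.presheaf.Γgerm x).hom (q.appTop.hom ((Scheme.ΓSpecIso (.of O)).inv.hom ϖ)) * a ∈ stalkIdeal C x →
          a ∈ stalkIdeal C x) :
    Flat (C.subschemeι ≫ q) := by
  -- adapted from `flat_carrierDelta_subschemeι_comp` (…NatCarrierDeltaFlat.lean, itself after
  -- `ZariskiChow.flat_of_isIntegral_of_surjective`)
  apply HasRingHomProperty.of_iSup_eq_top (P := @Flat) (fun V : C.subscheme.affineOpens => V) (iSup_affineOpens_eq_top _)
  intro V
  letI := ((C.subschemeι ≫ q).appLE ⊤ (V : C.subscheme.Opens) le_top).hom.toAlgebra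
  change Module.Flat Γ(Spec (.of O), ⊤) Γ(C.subscheme, V)
  let eR : O ≃+* Γ(Spec (.of O), ⊤) := (Scheme.ΓSpecIso (.of O)).symm.commRingCatIsoToRingEquiv
  haveI : IsDomain Γ(Spec (.of O), ⊤) := MulEquiv.isDomain O eR.symm.toMulEquiv
  haveI : IsPrincipalIdealRing Γ(Spec (.of O), ⊤) := IsPrincipalIdealRing.of_surjective eR.toRingHom eR.surjective
  rw [Module.Flat.flat_iff_torsion_eq_bot_of_isBezout, ← Submodule.isTorsionFree_iff_torsion_eq_bot]
  refine ⟨fun ρ hρ => ?_⟩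
  rw [isSMulRegular_iff_right_eq_zero_of_smul]
  intro m hm
  rw [Algebra.smul_def] at hm
  change ((C.subschemeι ≫ q).appLE ⊤ _ le_top).hom ρ * m = 0 at hm
  -- `ρ = u ϖⁿ`
  have hρ0 : eR.symm ρ ≠ 0 := fun h0 => hρ.ne_zero (by simpa using congrArg eR h0)
  obtain ⟨n, u, hu⟩ := IsDiscreteValuationRing.eq_unit_mul_pow_irreducible hρ0 hϖ
  have hρeq : ρ = eR (u : O) * eR ϖ ^ n := by
    rw [← map_pow, ← map_mul, ← hu, RingEquiv.apply_symm_apply]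
  have heR : ∀ a : O, eR a = (Scheme.ΓSpecIso (.of O)).inv.hom a := fun a => rfl
  -- KEY: `ϖ` is a nonzerodivisor on `Γ(V(C), V)` — checked on the stalks
  have hw : ∀ m' : Γ(C.subscheme, V), ((C.subschemeι ≫ q).appLE ⊤ _ le_top).hom (eR ϖ) * m' = 0 → m' = 0 := by
    intro m' hm'
    apply TopCat.Presheaf.section_ext C.subscheme.sheaf _ m' 0
    intro z hz
    rw [map_zero]
    have hgerm := congrArg (C.subscheme.presheaf.germ _ z hz).hom hm'
    rw [map_mul, map_zero, heR, germ_appLE_top, Scheme.Hom.stalkMap_comp] at hgerm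
    change (C.subschemeι.stalkMap z).hom ((q.stalkMap _).hom (((Spec (.of O)).presheaf.germ ⊤ _ trivial).hom
        ((Scheme.ΓSpecIso (.of O)).inv.hom ϖ))) * _ = 0 at hgerm
    by_cases hy : q (C.subschemeι z) = IsLocalRing.closedPoint O
    · -- over the closed point: `ϖ` is regular modulo `C_x` by hypothesis
      have hxC : C.subschemeι z ∈ (C.support : Set X) := by
        rw [← Scheme.IdealSheafData.range_subschemeι]; exact Set.mem_range_self z
      rw [Scheme.Hom.germ_stalkMap_apply] at hgerm
      change (C.subschemeι.stalkMap z).hom ((X.presheaf.Γgerm _).hom (q.appTop.hom ((Scheme.ΓSpecIso (.of O)).inv.hom ϖ))) * _ = 0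
        at hgerm
      obtain ⟨a, ha⟩ := C.subschemeι.stalkMap_surjective z ((C.subscheme.presheaf.germ _ z hz).hom m')
      have hker : RingHom.ker (C.subschemeι.stalkMap z).hom = stalkIdeal C (C.subschemeι z) := by
        rw [← stalkIdeal_ker_eq_ker_stalkMap, Scheme.IdealSheafData.ker_subschemeι]
      rw [← ha, ← map_mul, ← RingHom.mem_ker, hker] at hgerm
      have key := h _ hxC hy a hgerm
      change ((C.subscheme.presheaf.germ _ z hz).hom m') = 0
      rw [← ha, ← RingHom.mem_ker, hker]
      exact key
    · -- over the generic point: `ϖ` is a unit there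
      have hunit := ((isUnit_germ_of_ne_closedPoint O _ hy hϖ.ne_zero).map (q.stalkMap _).hom).map
        (C.subschemeι.stalkMap z).hom
      change ((C.subscheme.presheaf.germ _ z hz).hom m') = 0
      exact (hunit.mul_right_eq_zero).mp hgerm
  -- conclude: `ρ • m = u ϖⁿ m = 0 ⇒ m = 0`
  rw [hρeq, map_mul, map_pow, mul_assoc] at hm
  have hm' := ((u.isUnit.map eR).map _).mul_right_eq_zero.mp hm
  clear hm hρeq hu
  induction n generalizing m with
  | zero => simpa using hm'
  | succ n ih =>
    rw [pow_succ, mul_assoc] at hm'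
    exact hw m (ih _ hm')


/-! ## The germ of the uniformiser at a point over the closed point -/

/-- **Over the closed point, the germ `ϖ_x` of the uniformiser lies in `𝔪_x`** (`𝒪_{Spec O, 𝔪_O} → 𝒪_{X,x}` is local and `ϖ`
generates the maximal ideal downstairs). [folklore] -/
theorem germ_varpi_mem_maximalIdeal {X : Scheme.{0}} (q : X ⟶ Spec (.of O)) (ϖ : O) (hϖ : Irreducible ϖ) (x : X)
    (hx : q x = IsLocalRing.closedPoint O) :
    (X.presheaf.Γgerm x).hom (q.appTop.hom ((Scheme.ΓSpecIso (.of O)).inv.hom ϖ)) ∈ maximalIdeal (X.presheaf.stalk x) := by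
  set R := (Spec (.of O)).presheaf.stalk (q x) with hR
  letI : Algebra O R := StructureSheaf.stalkAlgebra O (q x)
  haveI : IsLocalization.AtPrime R (q x).asIdeal := StructureSheaf.IsLocalization.to_stalk O (q x)
  have hgalg : (q.stalkMap x).hom (algebraMap O R ϖ) =
      (X.presheaf.Γgerm x).hom (q.appTop.hom ((Scheme.ΓSpecIso (.of O)).inv.hom ϖ)) :=
    Summit.ResolutionOfSingularities.ResolutionOfSingularities.Cruxes.EquisingularLift.StrataSplit.stalkMap_Γgerm_apply' q x _
  rw [← hgalg]
  haveI : IsLocalHom (q.stalkMap x).hom := inferInstance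
  refine map_nonunit (q.stalkMap x).hom _ ?_
  have hpy : (q x).asIdeal = maximalIdeal O := by rw [hx]; rfl
  have h : algebraMap O R ϖ ∈ (q x).asIdeal.map (algebraMap O R) :=
    Ideal.mem_map_of_mem _ (by rw [hpy, hϖ.maximalIdeal_eq]; exact Ideal.mem_span_singleton_self ϖ)
  rwa [IsLocalization.AtPrime.map_eq_maximalIdeal (q x).asIdeal R] at h

/-! ## The centre criterion -/

/-- **THE CENTRE CRITERION (T-LIFT-CI, scheme level).** `O` a DVR with uniformiser `ϖ`, `X` locally Noetherian, `q : X → Spec O`,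
`C` an ideal sheaf on `X` with `V(C) → Spec O` universally closed. Suppose that at every point `x ∈ V(C)` over the CLOSED point:
`𝒪_{X,x}` is a regular local ring with `ϖ_x ∉ 𝔪_x²` (good reduction), and `C_x = (F₁,…,F_c)` for germs `Fᵢ ∈ 𝔪_x` with the
DOWNSTAIRS hypothesis «`Σ aᵢFᵢ ∈ 𝔪_x² + (ϖ_x) ⇒ aᵢ ∈ 𝔪_x`» (the reductions cut out a regular subscheme of the special fibre
TRANSVERSALLY: independent differentials). Then **`V(C)` is a regular scheme and `V(C) → Spec O` is flat** — clauses (b) and (c) of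
a HorizChainE1 step for the nose `C`. [cite: Matsumura1987, Thm. 14.2; Hartshorne1977, III Prop. 9.7] -/
theorem isRegular_and_flat_of_cotangentLift {X : Scheme.{0}} [IsLocallyNoetherian X] (q : X ⟶ Spec (.of O))
    (C : X.IdealSheafData) [UniversallyClosed (C.subschemeι ≫ q)] (ϖ : O) (hϖ : Irreducible ϖ)
    (h : ∀ x ∈ C.support, q x = IsLocalRing.closedPoint O →
      IsRegularLocalRing (X.presheaf.stalk x) ∧
      (X.presheaf.Γgerm x).hom (q.appTop.hom ((Scheme.ΓSpecIso (.of O)).inv.hom ϖ)) ∉ maximalIdeal (X.presheaf.stalk x) ^ 2 ∧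
      ∃ (c : ℕ) (F : Fin c → X.presheaf.stalk x), stalkIdeal C x = Ideal.span (Set.range F) ∧
        (∀ i, F i ∈ maximalIdeal (X.presheaf.stalk x)) ∧
        ∀ a : Fin c → X.presheaf.stalk x,
          ∑ i, a i * F i ∈ maximalIdeal (X.presheaf.stalk x) ^ 2 ⊔
            Ideal.span {(X.presheaf.Γgerm x).hom (q.appTop.hom ((Scheme.ΓSpecIso (.of O)).inv.hom ϖ))} →
          ∀ i, a i ∈ maximalIdeal (X.presheaf.stalk x)) :
    Scheme.IsRegular C.subscheme ∧ Flat (C.subschemeι ≫ q) := by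
  refine ⟨?_, ?_⟩
  · refine Scheme.isRegular_subscheme_of_forall_over_closedPoint q C fun x hxC hx => ?_
    obtain ⟨hreg, hϖ2, c, F, hCF, hF, hdown⟩ := h x hxC hx
    haveI := hreg
    rw [hCF]
    exact isRegularLocalRing_quotient_span_range_tail (germ_varpi_mem_maximalIdeal O q ϖ hϖ x hx) hϖ2 hF hdown
  · refine flat_subschemeι_comp_of_forall_stalk O q C ϖ hϖ fun x hxC hx a ha => ?_
    obtain ⟨hreg, hϖ2, c, F, hCF, hF, hdown⟩ := h x hxC hx
    haveI := hreg
    rw [hCF] at ha ⊢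
    exact mem_span_range_of_mul_mem (germ_varpi_mem_maximalIdeal O q ϖ hϖ x hx) hϖ2 hF hdown a ha

end CILift

end Summit.ResolutionOfSingularities.ResolutionOfSingularities.Cruxes.EquisingularLiftNat.Sections

end
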